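import Summits.RiemannHypothesis.RiemannHypothesis.Theorems.SigmaLLocalIvic
import HarnessLib

/-!
# Crux `SigmaL` (stmt-RiemannHypothesis-24253) — the CONE DECREMENT of `Z'/Z` (RH-free engine of the
# cone theorem `SigmaLBirth.laguerreAtCritical_of_offCone`)

Skeleton `SigmaL_birth`, registered stub

  `stub_laguerreAtCritical : ∀ t > 3·10¹², Z'(t) = 0 → Z(t) ≠ 0 → Z(t)·Z''(t) < 0`

(`Z = Literature.NumberTheory.LFunctions.hardyZ`). RH-free the stub is open (RH-strength). The window
theorem `SigmaLBirth.laguerreAtCritical_of_onLine` (`Theorems/HardyZLehmerSplitSigmaLLaguerreOfOnLine.lean`)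
derives its conclusion at `t` from "every zero of `ζ` with ordinate in `(t − 3/2, t + 9)` is on the
line". The cone files sharpen the hypothesis to the geometry that matters in the partial-fraction
formula: the term of a zero `β + iγ` in `Z'/Z(t) = Σ (t−γ)/((β−½)² + (t−γ)²) + c(t)` DEcreases in `t`
exactly where `|t − γ| > |β − ½|` (tree: `SigmaLRung.phi_sub_eq`), so only a zero whose CONE
`|u − γ| ≤ |β − ½|` covers `t` can push `(Z'/Z)'(t)` up. THIS module (route-independent imports only)
holds the series estimates:

* §1 `pairTerm_sub_nonneg_of_cone` — every pair term of the RH-free zero sum for `Z'/Z`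
  (`SigmaLRung.pairTerm`, `hasSum_pairTerm`) decreases across `[t₁, t₂]` when every zero in the strip
  is on the line or satisfies the cone condition `(β−½)² < (t₁−γ)(t₂−γ)`;
* §2 `phi_sub_ge_rate`, `tsum_decrement_cone` — one zero `ρ₀` (ANY real part) ahead of `[t₁, t₂]`
  within `C₀` and outside its DOUBLED cone (`4(β₀−½)² ≤ (γ₀−t₂)²`) makes the zero sum drop by
  `≥ (t₂−t₁)/(3C₀²)`;
* §3 `logDeriv_decrement_cone` — hence `Z'/Z` drops at rate `≥ 1/(3C₀²) − 4/a` on zero-free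
  intervals above `a ≥ 1` (`Ivic2003.corr_sub_le` for the Gamma-factor drift).

The cone theorem itself, its contrapositive CONE LOCATORS (a wrong-curvature critical point / Lehmer
violation of `Z` at `t ≥ 3·10¹²` forces an OFF-line zero `β + iγ` with `|γ − t| ≤ 2|β − ½| < 1`) and
the unit-padding window corollaries are `Theorems/HardyZLehmerSplitSigmaLLaguerreCone.lean`.
NOTHING HERE PROVES OR ASSUMES RH; the stub stays OPEN. References: Ivić 2003 §2 Prop. 1 [Ivic2003];
Edwards 1974 §8.3 [Edwards1974].
-/

set_option linter.dupNamespace false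
set_option autoImplicit false

noncomputable section

open Complex Filter Set
open scoped Real Topology
open Literature.NumberTheory.LFunctions
open Summit.RiemannHypothesis.RiemannHypothesis.Theorems.SigmaLRung

namespace Summit.RiemannHypothesis.RiemannHypothesis.Theorems.SigmaLBirth

/-! ## §1. One zero term outside its cone decreases -/

variable {b : ℕ → ℂ}

/-- **Every pair term decreases across `[t₁, t₂]` outside the cones.** If `ζ(½ + iu) ≠ 0` on
`[t₁, t₂]` and every zero `s = β + iγ` of `ζ` in the strip is on the line or satisfies the CONE
CONDITION `(β − ½)² < (t₁ − γ)(t₂ − γ)` (both endpoints on the same side of `γ`, at geometric-mean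
distance `> |β − ½|`), then `pairTerm b n t₁ ≥ pairTerm b n t₂`. (`SigmaLRung.pairTerm_sub_nonneg`
with its window hypothesis replaced by the cone condition, which is what `phi_sub_nonneg` uses; the
partner pole `−γ` is handled by the conjugate zero `β − iγ`.) RH-free. [folklore] -/
theorem pairTerm_sub_nonneg_of_cone (h : IsHadamardSeq 0 b) (n : ℕ) {t₁ t₂ : ℝ} (hlt : t₁ < t₂)
    (hZ : ∀ u ∈ Icc t₁ t₂, riemannZeta (1 / 2 + (u : ℂ) * I) ≠ 0)
    (hcone : ∀ s : ℂ, riemannZeta s = 0 → 0 < s.re → s.re < 1 →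
      s.re = 1 / 2 ∨ (s.re - 1 / 2) ^ 2 < (t₁ - s.im) * (t₂ - s.im)) :
    0 ≤ pairTerm b n t₁ - pairTerm b n t₂ := by
  by_cases hn : b n = 0
  · simp [pairTerm, hn]
  obtain ⟨hζ, h0, h1⟩ := h.riemannZeta_xiZero hn
  rw [pairTerm_eq hn, pairTerm_eq hn]
  set ρ : ℂ := IsHadamardSeq.xiZero b n with hρdef
  set β : ℝ := ρ.re with hβdef
  set γ : ℝ := ρ.im with hγdef
  have hd0 : 0 ≤ (1 / 2 - β) ^ 2 := sq_nonneg _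
  have hρeq : ρ = (β : ℂ) + (γ : ℂ) * I := by
    apply Complex.ext <;> simp [hβdef, hγdef]
  -- the conjugate zero `β − iγ`
  have hζc : riemannZeta ((β : ℂ) + ((-γ : ℝ) : ℂ) * I) = 0 := by
    have e : (starRingEnd ℂ) ρ = (β : ℂ) + ((-γ : ℝ) : ℂ) * I := by
      apply Complex.ext <;> simp [hβdef, hγdef]
    rw [← e, riemannZeta_conj, hζ, map_zero]
  -- on-line zeros: the pole is not in `[t₁, t₂]` since `ζ(½ + iu) ≠ 0` there
  have honline : ∀ γ' : ℝ, riemannZeta (1 / 2 + (γ' : ℂ) * I) = 0 → 0 < (t₁ - γ') * (t₂ - γ') := by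
    intro γ' hγ'
    by_contra hle
    push Not at hle
    obtain ⟨hl, hr⟩ := mem_Icc_of_mul_nonpos hle hlt.le
    exact hZ γ' ⟨hl, hr⟩ hγ'
  -- first summand: `(½−β)² < (t₁ − γ)(t₂ − γ)`
  have h1st : (1 / 2 - β) ^ 2 < (t₁ - γ) * (t₂ - γ) := by
    rcases hcone ρ hζ h0 h1 with hβ | hc
    · have hβ' : β = 1 / 2 := hβ
      have hd : (1 / 2 - β) ^ 2 = 0 := by rw [hβ']; norm_num
      rw [hd]
      refine honline γ ?_
      have e : (1 / 2 : ℂ) + (γ : ℂ) * I = ρ := by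
        rw [hρeq, hβ']; push_cast; ring
      rw [e]; exact hζ
    · have e : (1 / 2 - β) ^ 2 = (β - 1 / 2) ^ 2 := by ring
      rw [e]; exact hc
  -- second summand: `(½−β)² < (t₁ + γ)(t₂ + γ)` (the pole `−γ`, from the conjugate zero)
  have h2nd : (1 / 2 - β) ^ 2 < (t₁ + γ) * (t₂ + γ) := by
    rcases hcone _ hζc (by simpa using h0) (by simpa using h1) with hβ | hc
    · have hβ' : β = 1 / 2 := by simpa using hβ
      have hd : (1 / 2 - β) ^ 2 = 0 := by rw [hβ']; norm_num
      rw [hd]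
      have e : (t₁ + γ) * (t₂ + γ) = (t₁ - -γ) * (t₂ - -γ) := by ring
      rw [e]
      refine honline (-γ) ?_
      have e' : (1 / 2 : ℂ) + ((-γ : ℝ) : ℂ) * I = (β : ℂ) + ((-γ : ℝ) : ℂ) * I := by
        rw [hβ']; push_cast; ring
      rw [e']; exact hζc
    · have e : (1 / 2 - β) ^ 2 = (β - 1 / 2) ^ 2 := by ring
      have e' : (t₁ + γ) * (t₂ + γ) = (t₁ - -γ) * (t₂ - -γ) := by ring
      rw [e, e']
      simpa using hc
  have e1 := phi_sub_nonneg hd0 h1st (by linarith : t₁ - γ ≤ t₂ - γ)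
  have e2 := phi_sub_nonneg hd0 h2nd (by linarith : t₁ + γ ≤ t₂ + γ)
  linarith

/-! ## §2. The rate: one zero ahead of `[t₁, t₂]`, within `C₀`, outside its doubled cone -/

/-- **Quantitative decrease of one term outside the DOUBLED cone.** For `d ≥ 0`, `t₁ < t₂ < γ₀`,
`γ₀ ≤ t₁ + C₀` and `4d ≤ (γ₀ − t₂)²`:
`φ_d(t₁−γ₀) − φ_d(t₂−γ₀) ≥ (t₂−t₁)/(3C₀²)` where `φ_d(u) = u/(d+u²)` (by `phi_sub_eq` the drop is
`(t₂−t₁)(P−d)/((d+u₁²)(d+u₂²))`, `P = (γ₀−t₁)(γ₀−t₂) ≤ C₀²`, and `d ≤ P/4` gives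
`(d+u₁²)(d+u₂²) ≤ (25/16)P² ≤ (9/4)P² ≤ 3C₀²(P−d)`). [folklore] -/
theorem phi_sub_ge_rate {d t₁ t₂ γ₀ C₀ : ℝ} (hd : 0 ≤ d) (hlt : t₁ < t₂) (hγ₂ : t₂ < γ₀)
    (hγC : γ₀ ≤ t₁ + C₀) (hdc : 4 * d ≤ (γ₀ - t₂) ^ 2) :
    (t₂ - t₁) / (3 * C₀ ^ 2) ≤
      (t₁ - γ₀) / (d + (t₁ - γ₀) ^ 2) - (t₂ - γ₀) / (d + (t₂ - γ₀) ^ 2) := by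
  set v₁ : ℝ := γ₀ - t₁ with hv₁
  set v₂ : ℝ := γ₀ - t₂ with hv₂
  have hv₂pos : 0 < v₂ := by rw [hv₂]; linarith
  have hv₁₂ : v₂ < v₁ := by rw [hv₁, hv₂]; linarith
  have hv₁pos : 0 < v₁ := hv₂pos.trans hv₁₂
  have hv₁C : v₁ ≤ C₀ := by rw [hv₁]; linarith
  have hC₀ : 0 < C₀ := hv₁pos.trans_le hv₁C
  set P : ℝ := v₁ * v₂ with hP
  have hPpos : 0 < P := mul_pos hv₁pos hv₂pos
  have hv₂P : v₂ ^ 2 ≤ P := by rw [hP, sq]; exact mul_le_mul_of_nonneg_right hv₁₂.le hv₂pos.le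
  have hdP : d ≤ P / 4 := by linarith
  have hPC : P ≤ C₀ ^ 2 := by
    rw [hP, sq]
    exact mul_le_mul hv₁C (hv₁₂.le.trans hv₁C) hv₂pos.le hC₀.le
  have eu₁ : (t₁ - γ₀) ^ 2 = v₁ ^ 2 := by rw [hv₁]; ring
  have eu₂ : (t₂ - γ₀) ^ 2 = v₂ ^ 2 := by rw [hv₂]; ring
  have hD₁ : 0 < d + (t₁ - γ₀) ^ 2 := by rw [eu₁]; have := pow_pos hv₁pos 2; linarith
  have hD₂ : 0 < d + (t₂ - γ₀) ^ 2 := by rw [eu₂]; have := pow_pos hv₂pos 2; linarith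
  rw [phi_sub_eq hD₁.ne' hD₂.ne']
  have eP : (t₁ - γ₀) * (t₂ - γ₀) = P := by rw [hP, hv₁, hv₂]; ring
  have e21 : t₂ - γ₀ - (t₁ - γ₀) = t₂ - t₁ := by ring
  rw [eu₁, eu₂, eP, e21]
  -- `(d + v₁²)(d + v₂²) ≤ (25/16) P²` and `3 C₀² (P − d) ≥ (9/4) P²`
  have hdd : d ^ 2 ≤ P ^ 2 / 16 := by nlinarith
  have hdv₁ : d * v₁ ^ 2 ≤ P ^ 2 / 4 := by
    have : d * v₁ ^ 2 ≤ (v₂ ^ 2 / 4) * v₁ ^ 2 :=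
      mul_le_mul_of_nonneg_right (by linarith) (sq_nonneg _)
    have e : (v₂ ^ 2 / 4) * v₁ ^ 2 = P ^ 2 / 4 := by rw [hP]; ring
    linarith
  have hdv₂ : d * v₂ ^ 2 ≤ P ^ 2 / 4 := by
    have : d * v₂ ^ 2 ≤ (P / 4) * P := mul_le_mul hdP hv₂P (sq_nonneg _) (by linarith)
    linarith
  have hden : (d + v₁ ^ 2) * (d + v₂ ^ 2) ≤ 25 / 16 * P ^ 2 := by
    have e : (d + v₁ ^ 2) * (d + v₂ ^ 2) = d ^ 2 + d * v₁ ^ 2 + d * v₂ ^ 2 + P ^ 2 := by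
      rw [hP]; ring
    rw [e]; linarith
  have hnum : 9 / 4 * P ^ 2 ≤ 3 * C₀ ^ 2 * (P - d) := by
    have h34 : 3 / 4 * P ≤ P - d := by linarith
    have : 3 * P * (3 / 4 * P) ≤ 3 * C₀ ^ 2 * (P - d) :=
      mul_le_mul (by linarith) h34 (by linarith) (by positivity)
    linarith
  have hDpos : 0 < (d + v₁ ^ 2) * (d + v₂ ^ 2) := by positivity
  rw [div_le_div_iff₀ (by positivity) hDpos]
  have h21 : 0 < t₂ - t₁ := sub_pos.2 hlt
  have key : (d + v₁ ^ 2) * (d + v₂ ^ 2) ≤ (P - d) * (3 * C₀ ^ 2) := by linarith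
  calc (t₂ - t₁) * ((d + v₁ ^ 2) * (d + v₂ ^ 2)) ≤ (t₂ - t₁) * ((P - d) * (3 * C₀ ^ 2)) :=
        mul_le_mul_of_nonneg_left key h21.le
    _ = (t₂ - t₁) * (P - d) * (3 * C₀ ^ 2) := by ring

/-- **The zero sum drops by at least `(t₂−t₁)/(3C₀²)` across a zero-free `[t₁, t₂]` outside the
cones** when some zero `ρ₀ = β₀ + iγ₀` of `ζ` (ANY real part) has `t₂ < γ₀ ≤ t₁ + C₀` and
`4(β₀−½)² ≤ (γ₀−t₂)²` (doubled cone): every term decreases (`pairTerm_sub_nonneg_of_cone`) and the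
near summand of the term of `ρ₀` alone loses `≥ (t₂−t₁)/(3C₀²)` (`phi_sub_ge_rate`). RH-free;
`SigmaLRung.tsum_decrement_local` is the case `β₀ = ½`. [folklore] -/
theorem tsum_decrement_cone (h : IsHadamardSeq 0 b) {a a' t₁ t₂ C₀ : ℝ} {ρ₀ : ℂ} (ha : 0 ≤ a)
    (hfree : ∀ t ∈ Ioo a a', hardyZ t ≠ 0) (ht₁ : t₁ ∈ Ioo a a') (ht₂ : t₂ ∈ Ioo a a')
    (hlt : t₁ < t₂)
    (hcone : ∀ s : ℂ, riemannZeta s = 0 → 0 < s.re → s.re < 1 →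
      s.re = 1 / 2 ∨ (s.re - 1 / 2) ^ 2 < (t₁ - s.im) * (t₂ - s.im))
    (hρ₀ : riemannZeta ρ₀ = 0) (h0 : 0 < ρ₀.re) (h1 : ρ₀.re < 1)
    (hγ₂ : t₂ < ρ₀.im) (hγC : ρ₀.im ≤ t₁ + C₀) (hdc : 4 * (ρ₀.re - 1 / 2) ^ 2 ≤ (ρ₀.im - t₂) ^ 2) :
    (t₂ - t₁) / (3 * C₀ ^ 2) ≤ ∑' n, pairTerm b n t₁ - ∑' n, pairTerm b n t₂ := by
  have hZ : ∀ t ∈ Ioo a a', riemannZeta (1 / 2 + (t : ℂ) * I) ≠ 0 := fun t ht h0' ↦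
    hfree t ht ((hardyZ_eq_zero_iff_holds t).2 h0')
  have hξ₁ : riemannXi ((1 / 2 : ℂ) + (t₁ : ℂ) * I) ≠ 0 := fun h0' ↦
    hZ t₁ ht₁ ((riemannXi_eq_zero_iff_holds _).1 h0').1
  have hξ₂ : riemannXi ((1 / 2 : ℂ) + (t₂ : ℂ) * I) ≠ 0 := fun h0' ↦
    hZ t₂ ht₂ ((riemannXi_eq_zero_iff_holds _).1 h0').1
  have hsum₁ := (hasSum_pairTerm h hξ₁).summable
  have hsum₂ := (hasSum_pairTerm h hξ₂).summable
  rw [← hsum₁.tsum_sub hsum₂]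
  have hZIcc : ∀ u ∈ Icc t₁ t₂, riemannZeta (1 / 2 + (u : ℂ) * I) ≠ 0 := fun u hu ↦
    hZ u ⟨ht₁.1.trans_le hu.1, hu.2.trans_lt ht₂.2⟩
  have hnonneg : ∀ n, 0 ≤ pairTerm b n t₁ - pairTerm b n t₂ := fun n ↦
    pairTerm_sub_nonneg_of_cone h n hlt hZIcc hcone
  -- the index of `ρ₀`
  have hξρ : riemannXi ρ₀ = 0 := (riemannXi_eq_zero_iff_holds _).2 ⟨hρ₀, h0, h1⟩
  obtain ⟨n₀, hn₀, hcases⟩ := Ivic2003.exists_index_of_riemannXi_eq_zero h hξρ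
  set β₀ : ℝ := ρ₀.re with hβ₀
  set γ₀ : ℝ := ρ₀.im with hγ₀
  set d : ℝ := (β₀ - 1 / 2) ^ 2 with hd
  have hd0 : 0 ≤ d := sq_nonneg _
  have ht₁pos : 0 < t₁ := ha.trans_lt ht₁.1
  -- the near summand: poles at `γ₀`, quantitative
  have hnear : (t₂ - t₁) / (3 * C₀ ^ 2) ≤
      (t₁ - γ₀) / (d + (t₁ - γ₀) ^ 2) - (t₂ - γ₀) / (d + (t₂ - γ₀) ^ 2) :=
    phi_sub_ge_rate hd0 hlt hγ₂ hγC (by rw [hd]; linarith)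
  -- the far summand: poles at `−γ₀`, decreasing
  have hfar : 0 ≤ (t₁ + γ₀) / (d + (t₁ + γ₀) ^ 2) - (t₂ + γ₀) / (d + (t₂ + γ₀) ^ 2) := by
    refine phi_sub_nonneg hd0 ?_ (by linarith)
    have hlt' : (γ₀ - t₂) ^ 2 < (t₁ + γ₀) * (t₂ + γ₀) := by nlinarith
    nlinarith
  have hterm : (t₂ - t₁) / (3 * C₀ ^ 2) ≤ pairTerm b n₀ t₁ - pairTerm b n₀ t₂ := by
    rw [pairTerm_eq hn₀, pairTerm_eq hn₀]
    rcases hcases with hc | hc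
    · -- `xiZero = ρ₀`
      have hre : (IsHadamardSeq.xiZero b n₀).re = β₀ := by rw [← hc]
      have him : (IsHadamardSeq.xiZero b n₀).im = γ₀ := by rw [← hc]
      rw [hre, him]
      have e : (1 / 2 - β₀) ^ 2 = d := by rw [hd]; ring
      rw [e]
      linarith
    · -- `xiZero = 1 − ρ₀`
      have hx : IsHadamardSeq.xiZero b n₀ = 1 - ρ₀ := by rw [hc]; ring
      have hre : (IsHadamardSeq.xiZero b n₀).re = 1 - β₀ := by rw [hx]; simp [hβ₀]
      have him : (IsHadamardSeq.xiZero b n₀).im = -γ₀ := by rw [hx]; simp [hγ₀]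
      rw [hre, him]
      have e : (1 / 2 - (1 - β₀)) ^ 2 = d := by rw [hd]; ring
      have e1 : ∀ t : ℝ, t - -γ₀ = t + γ₀ := fun t ↦ by ring
      have e2 : ∀ t : ℝ, t + -γ₀ = t - γ₀ := fun t ↦ by ring
      rw [e, e1, e1, e2, e2]
      linarith
  exact hterm.trans ((hsum₁.sub hsum₂).le_tsum n₀ fun j _ ↦ hnonneg j)

/-! ## §3. The linear decrement of `Z'/Z` outside the cones -/

/-- **Linear decrement of `Z'/Z` outside the cones.** On a zero-free interval `(a, a')` of `Z`,
`a ≥ 1`, for `a < t₁ < t₂ < a'`: if every zero of `ζ` in the strip is on the line or satisfies the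
cone condition `(β−½)² < (t₁−γ)(t₂−γ)`, and some zero `ρ₀` has `t₂ < γ₀ ≤ t₁ + C₀`,
`4(β₀−½)² ≤ (γ₀−t₂)²`, then `(t₂ − t₁)(1/(3C₀²) − 4/a) ≤ Z'/Z(t₁) − Z'/Z(t₂)`
(`Z'/Z = Σ pairTerm + c(t)`, `Ivic2003.deriv_hardyZ_div_eq`; the zero sum drops by
`tsum_decrement_cone`, the correction rises by `≤ 4(t₂−t₁)/t₁`, `Ivic2003.corr_sub_le`). RH-free.
[cite: Ivic2003, §2, proof of Prop. 1 (cone form)] -/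
theorem logDeriv_decrement_cone {a a' t₁ t₂ C₀ : ℝ} {ρ₀ : ℂ} (ha1 : 1 ≤ a)
    (hfree : ∀ t ∈ Ioo a a', hardyZ t ≠ 0) (ht₁ : t₁ ∈ Ioo a a') (ht₂ : t₂ ∈ Ioo a a')
    (hlt : t₁ < t₂)
    (hcone : ∀ s : ℂ, riemannZeta s = 0 → 0 < s.re → s.re < 1 →
      s.re = 1 / 2 ∨ (s.re - 1 / 2) ^ 2 < (t₁ - s.im) * (t₂ - s.im))
    (hρ₀ : riemannZeta ρ₀ = 0) (h0 : 0 < ρ₀.re) (h1 : ρ₀.re < 1)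
    (hγ₂ : t₂ < ρ₀.im) (hγC : ρ₀.im ≤ t₁ + C₀) (hdc : 4 * (ρ₀.re - 1 / 2) ^ 2 ≤ (ρ₀.im - t₂) ^ 2) :
    (t₂ - t₁) * (1 / (3 * C₀ ^ 2) - 4 / a) ≤
      deriv hardyZ t₁ / hardyZ t₁ - deriv hardyZ t₂ / hardyZ t₂ := by
  obtain ⟨d, hd⟩ := exists_isHadamardSeq 0
  have hZ : ∀ t ∈ Ioo a a', riemannZeta (1 / 2 + (t : ℂ) * I) ≠ 0 := fun t ht h0' ↦
    hfree t ht ((hardyZ_eq_zero_iff_holds t).2 h0')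
  have hform : ∀ t ∈ Ioo a a', deriv hardyZ t / hardyZ t =
      (∑' n, pairTerm d n t) +
        (-(2 * t / (t ^ 2 + 1 / 4)) +
          (Complex.digamma ((1 / 4 : ℂ) + ((t / 2 : ℝ) : ℂ) * I)).im / 2) := by
    intro t ht
    have hξ : riemannXi ((1 / 2 : ℂ) + (t : ℂ) * I) ≠ 0 := fun h0' ↦
      hZ t ht ((riemannXi_eq_zero_iff_holds _).1 h0').1
    rw [Ivic2003.deriv_hardyZ_div_eq (hZ t ht), Ivic2003.neg_im_logDeriv_zeta_critPt (hZ t ht),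
      ← (hasSum_pairTerm hd hξ).tsum_eq]
    ring
  rw [hform t₁ ht₁, hform t₂ ht₂]
  have hat₁ : a < t₁ := ht₁.1
  have hS := tsum_decrement_cone hd (by linarith) hfree ht₁ ht₂ hlt hcone hρ₀ h0 h1 hγ₂ hγC hdc
  have hc := Ivic2003.corr_sub_le (by linarith : (1 : ℝ) ≤ t₁) hlt.le
  have hapos : 0 < a := by linarith
  have hca : 4 * (t₂ - t₁) / t₁ ≤ 4 * (t₂ - t₁) / a :=
    div_le_div_of_nonneg_left (by linarith) hapos hat₁.le
  have e : (t₂ - t₁) * (1 / (3 * C₀ ^ 2) - 4 / a) =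
      (t₂ - t₁) / (3 * C₀ ^ 2) - 4 * (t₂ - t₁) / a := by ring
  rw [e]
  linarith

end Summit.RiemannHypothesis.RiemannHypothesis.Theorems.SigmaLBirth

end
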